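import Summits.CriticalPhenomena.PercolationContinuityZ3.Theses.PercDustRigidity
import Literature.Probability.Percolation.ZeroOneLaw
import Literature.Probability.Percolation.RSW
import Literature.Probability.Percolation.SiteConnectionTools
import HarnessLib

/-!
# `PercDustRigidity.BernoulliStationaryPortrait` (stmt-CriticalPhenomena-9595), settled: `P_{p_c}` on `ℤ³`
# is lattice-supported, translation-invariant, `ℤ³`-ergodic, ergodic under every non-zero shift, and
# automorphism-invariant

RSW3 lane (cell `prim-rsw3`, prover P2, gen 31).  Closes the support item AS FILED; every clause is an
existing tree fact about Bernoulli bond percolation (nothing specific to `p_c`, nothing uses p205010):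
lattice support `ae_subset_edgeSet`; invariance under the graph automorphisms of `ℤ³` (in particular the
shifts `zdShiftIso v`, whose underlying equivalence is `Site.shift v`) `bondPercolation_map_relabel_iso`;
ergodicity of every non-zero shift `ergodic_relabel_shift_bondPercolation`, whence a measurable event
invariant under all shifts is invariant under the shift by `e₀ ≠ 0` and has probability `0` or `1`
(`PreErgodic.prob_eq_zero_or_one`).
-/

noncomputable section

namespace Summit.CriticalPhenomena.PercolationContinuityZ3.Theorems.BernoulliPortrait

open MeasureTheory Literature.Probability.Percolation Literature.Probability.LatticeModels

/-- Invariance of `P_p` on `ℤ^d` under a graph automorphism, on measurable sets (measure form). -/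
theorem measure_preimage_relabel_iso {d : ℕ} (p : unitInterval) (γ : zdGraph d ≃g zdGraph d)
    {A : Set (BondConfig (Site d))} (hA : MeasurableSet A) :
    bondPercolation (zdGraph d) p (BondConfig.relabel (sym2Equiv γ.toEquiv) ⁻¹' A) = bondPercolation (zdGraph d) p A := by
  rw [← Measure.map_apply (BondConfig.relabel _).measurable hA, bondPercolation_map_relabel_iso]

/-- **`PercDustRigidity.BernoulliStationaryPortrait` (stmt-CriticalPhenomena-9595), settled.**  `P_{p_c}` on
`ℤ³`: (1) is carried by lattice configurations; (2) is invariant under every shift (on measurable sets);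
(3) gives probability `0` or `1` to every measurable event invariant under all shifts; (4) is ergodic under
every single non-zero shift; (5) is invariant under every graph automorphism of `ℤ³`. -/
theorem bernoulliStationaryPortrait_proof :
    Summit.CriticalPhenomena.PercolationContinuityZ3.Theses.PercDustRigidity.BernoulliStationaryPortrait := by
  refine ⟨ae_subset_edgeSet _ _, ?_, ?_, ?_, ?_⟩
  · -- (2) translation invariance: the shift by `v` is the automorphism `zdShiftIso v`
    intro v S hS
    exact measure_preimage_relabel_iso (criticalProbI 3) (zdShiftIso v) hS
  · -- (3) `ℤ³`-ergodicity from the ergodicity of one non-zero shift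
    intro S hS hinv
    have hv : (Pi.single 0 1 : Site 3) ≠ 0 := by
      intro h
      have := congrFun h 0
      simp at this
    exact (ergodic_relabel_shift_bondPercolation (criticalProbI 3) hv).toPreErgodic.prob_eq_zero_or_one hS
      (hinv _)
  · -- (4) ergodicity under every non-zero shift
    intro v hv
    exact ergodic_relabel_shift_bondPercolation (criticalProbI 3) hv
  · -- (5) automorphism invariance
    intro γ A hA
    exact measure_preimage_relabel_iso (criticalProbI 3) γ hA

/-- **Shift invariance of `P_{p_c}` on measurable sets** (clause 2 of the portrait, extracted for users). -/
theorem measure_preimage_shift_criticalProbI (v : Site 3) {S : Set (BondConfig (Site 3))} (hS : MeasurableSet S) :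
    bondPercolation (zdGraph 3) (criticalProbI 3) (BondConfig.relabel (sym2Equiv (Site.shift v)) ⁻¹' S) =
      bondPercolation (zdGraph 3) (criticalProbI 3) S :=
  bernoulliStationaryPortrait_proof.2.1 v S hS

end Summit.CriticalPhenomena.PercolationContinuityZ3.Theorems.BernoulliPortrait
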